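import Summits.QuantumAdvantage.QuantumAdvantage.Theorems.WalkTwoStepDensePeelCylinder

/-!
# (G♯) local engine — `DensePinned p` by INVOLUTION PEELING, 2/5: involution peeling and the corner-flip glue

See `WalkTwoStepDensePeelCylinder` (1/5) for the architecture.  THIS MODULE: §3 abstract involution peeling (`card_filter_eq_half`,
`peel`: commuting involutions preserving `Q` and each other's events and flipping `win` on `Q ∩ E_i` leave a bias of at most
`#(Q ∖ ⋃ E_i)/2`) and §4 (corner flips preserve parts, `cornerFlip_mem_part`; the block form of the peeling event,
`peelEvent_of_blockEvent`; reachability of the event from every entry weight, `blockEvent_reachable`; greedy selection of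
`ℓ`-separated positions, `select`).
-/

namespace Summit.QuantumAdvantage.AdviceFreeQNC0.LocalEngine

open Finset Classical
open Summit.QuantumAdvantage.AdviceFreeQNC0.Coset21.RungG (classOf)

namespace DensePeel

/-! ### §3 Abstract involution peeling (PROVED) -/

section Peel

/-- An involution of `B` that flips `win` splits `B` evenly. -/
theorem card_filter_eq_half {X : Type*} [DecidableEq X] (win : X → Bool) (φ : X → X) (hφ : ∀ u, φ (φ u) = u)
    (B : Finset X) (hB : ∀ u ∈ B, φ u ∈ B) (hflip : ∀ u ∈ B, win (φ u) ≠ win u) :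
    (((B.filter fun u => win u = true).card : ℝ)) = (B.card : ℝ) / 2 := by
  have h1 : (B.filter fun u => win u ≠ win (φ u)).card ≤ 2 * (B.filter fun u => win u = true).card :=
    card_discordant_le_two_mul_card_true win φ hφ B hB
  have h2 : (B.filter fun u => (!win u) ≠ (!win (φ u))).card ≤ 2 * (B.filter fun u => (!win u) = true).card :=
    card_discordant_le_two_mul_card_true (fun u => !win u) φ hφ B hB
  have e1 : (B.filter fun u => win u ≠ win (φ u)) = B :=
    Finset.filter_true_of_mem fun u hu h => hflip u hu h.symm
  have e2 : (B.filter fun u => (!win u) ≠ (!win (φ u))) = B := by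
    apply Finset.filter_true_of_mem
    intro u hu h
    apply hflip u hu
    have h' := congrArg (fun b => !b) h
    simpa using h'.symm
  have e3 : (B.filter fun u => (!win u) = true) = B.filter fun u => ¬ (win u = true) := by
    apply Finset.filter_congr
    intro u _
    cases win u <;> simp
  have hsum : (B.filter fun u => win u = true).card + (B.filter fun u => ¬ (win u = true)).card = B.card :=
    Finset.card_filter_add_card_filter_not (s := B) (fun u => win u = true)
  rw [e1] at h1
  rw [e2, e3] at h2
  have h3 : 2 * (B.filter fun u => win u = true).card = B.card := by omega
  have hr : (2 : ℝ) * ((B.filter fun u => win u = true).card : ℝ) = (B.card : ℝ) := by exact_mod_cast h3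
  linarith

/-- **Involution peeling.** Commuting involutions `ψ i` preserving `Q`, each preserving the other events and flipping `win` on
`Q ∩ E i`: the bias of `Q` is carried by the inputs that escape every event. -/
theorem peel {X ι : Type*} [DecidableEq X] (win : X → Bool) (ψ : ι → X → X) (E : ι → X → Prop)
    (hinv : ∀ i u, ψ i (ψ i u) = u) (hcomm : ∀ i j u, ψ i (ψ j u) = ψ j (ψ i u))
    (hE : ∀ i j u, i ≠ j → (E j (ψ i u) ↔ E j u)) (L : List ι) :
    ∀ Q : Finset X, (∀ i ∈ L, ∀ u ∈ Q, ψ i u ∈ Q) → (∀ i ∈ L, ∀ u ∈ Q, E i u → win (ψ i u) ≠ win u) →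
      |(((Q.filter fun u => win u = true).card : ℝ)) - (Q.card : ℝ) / 2|
        ≤ ((Q.filter fun u => ∀ i ∈ L, ¬ E i u).card : ℝ) / 2 := by
  induction L with
  | nil =>
    intro Q _ _
    have e : (Q.filter fun u => ∀ i ∈ ([] : List ι), ¬ E i u) = Q :=
      Finset.filter_true_of_mem fun u _ i hi => by simp at hi
    rw [e]
    have h0 : (0 : ℝ) ≤ ((Q.filter fun u => win u = true).card : ℝ) := by positivity
    have h1 : (((Q.filter fun u => win u = true).card : ℝ)) ≤ (Q.card : ℝ) := by
      exact_mod_cast Finset.card_filter_le Q _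
    rw [abs_le]
    constructor <;> linarith
  | cons i L ih =>
    intro Q hQ hflip
    have hiL : i ∈ i :: L := List.mem_cons_self
    have hBmap : ∀ u ∈ Q.filter (fun u => E i u ∨ E i (ψ i u)), ψ i u ∈ Q.filter (fun u => E i u ∨ E i (ψ i u)) := by
      intro u hu
      rw [Finset.mem_filter] at hu ⊢
      refine ⟨hQ i hiL u hu.1, ?_⟩
      rcases hu.2 with h | h
      · right; rw [hinv]; exact h
      · left; exact h
    have hBflip : ∀ u ∈ Q.filter (fun u => E i u ∨ E i (ψ i u)), win (ψ i u) ≠ win u := by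
      intro u hu
      rw [Finset.mem_filter] at hu
      rcases hu.2 with h | h
      · exact hflip i hiL u hu.1 h
      · have h' := hflip i hiL (ψ i u) (hQ i hiL u hu.1) h
        rw [hinv] at h'
        exact fun h'' => h' h''.symm
    have hhalf := card_filter_eq_half win (ψ i) (hinv i) _ hBmap hBflip
    have hQ₁ : ∀ j ∈ L, ∀ u ∈ Q.filter (fun u => ¬ (E i u ∨ E i (ψ i u))),
        ψ j u ∈ Q.filter (fun u => ¬ (E i u ∨ E i (ψ i u))) := by
      intro j hj u hu
      rw [Finset.mem_filter] at hu ⊢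
      refine ⟨hQ j (List.mem_cons_of_mem i hj) u hu.1, ?_⟩
      by_cases hji : j = i
      · subst hji
        intro h
        apply hu.2
        rcases h with h | h
        · exact Or.inr h
        · rw [hinv] at h; exact Or.inl h
      · intro h
        apply hu.2
        rcases h with h | h
        · exact Or.inl ((hE j i u hji).mp h)
        · rw [hcomm, hE j i _ hji] at h
          exact Or.inr h
    have hflip₁ : ∀ j ∈ L, ∀ u ∈ Q.filter (fun u => ¬ (E i u ∨ E i (ψ i u))), E j u → win (ψ j u) ≠ win u := by
      intro j hj u hu
      rw [Finset.mem_filter] at hu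
      exact hflip j (List.mem_cons_of_mem i hj) u hu.1
    have hih := ih _ hQ₁ hflip₁
    -- cardinal bookkeeping
    have c1 : ((Q.filter fun u => win u = true).card : ℝ)
        = (((Q.filter fun u => E i u ∨ E i (ψ i u)).filter fun u => win u = true).card : ℝ)
          + (((Q.filter fun u => ¬ (E i u ∨ E i (ψ i u))).filter fun u => win u = true).card : ℝ) := by
      have h := Finset.card_filter_add_card_filter_not (s := Q.filter fun u => win u = true) (fun u => E i u ∨ E i (ψ i u))
      have e1 : ((Q.filter fun u => E i u ∨ E i (ψ i u)).filter fun u => win u = true)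
          = (Q.filter fun u => win u = true).filter fun u => E i u ∨ E i (ψ i u) := by
        rw [Finset.filter_filter, Finset.filter_filter]
        exact Finset.filter_congr fun u _ => and_comm
      have e2 : ((Q.filter fun u => ¬ (E i u ∨ E i (ψ i u))).filter fun u => win u = true)
          = (Q.filter fun u => win u = true).filter fun u => ¬ (E i u ∨ E i (ψ i u)) := by
        rw [Finset.filter_filter, Finset.filter_filter]
        exact Finset.filter_congr fun u _ => and_comm
      rw [e1, e2]
      exact_mod_cast h.symm
    have c2 : (Q.card : ℝ) = ((Q.filter fun u => E i u ∨ E i (ψ i u)).card : ℝ)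
        + ((Q.filter fun u => ¬ (E i u ∨ E i (ψ i u))).card : ℝ) := by
      exact_mod_cast (Finset.card_filter_add_card_filter_not (s := Q) (fun u => E i u ∨ E i (ψ i u))).symm
    have c3 : (((Q.filter fun u => ¬ (E i u ∨ E i (ψ i u))).filter fun u => ∀ j ∈ L, ¬ E j u).card : ℝ)
        ≤ ((Q.filter fun u => ∀ j ∈ (i :: L), ¬ E j u).card : ℝ) := by
      have hsub : ((Q.filter fun u => ¬ (E i u ∨ E i (ψ i u))).filter fun u => ∀ j ∈ L, ¬ E j u)
          ⊆ Q.filter fun u => ∀ j ∈ (i :: L), ¬ E j u := by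
        intro u hu
        simp only [Finset.mem_filter] at hu ⊢
        refine ⟨hu.1.1, ?_⟩
        intro j hj
        rcases List.mem_cons.mp hj with rfl | hj
        · exact fun h => hu.1.2 (Or.inl h)
        · exact hu.2 j hj
      exact_mod_cast Finset.card_le_card hsub
    rw [c1, c2, hhalf]
    have e : (((Q.filter fun u => E i u ∨ E i (ψ i u)).card : ℝ)) / 2
          + ((((Q.filter fun u => ¬ (E i u ∨ E i (ψ i u))).filter fun u => win u = true).card : ℝ))
          - ((((Q.filter fun u => E i u ∨ E i (ψ i u)).card : ℝ))
              + (((Q.filter fun u => ¬ (E i u ∨ E i (ψ i u))).card : ℝ))) / 2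
        = ((((Q.filter fun u => ¬ (E i u ∨ E i (ψ i u))).filter fun u => win u = true).card : ℝ))
          - (((Q.filter fun u => ¬ (E i u ∨ E i (ψ i u))).card : ℝ)) / 2 := by ring
    rw [e]
    exact le_trans hih (by linarith)

end Peel

/-! ### §4 Corner flips preserve parts; block form of the peeling event; reachability; selection (PROVED) -/

section Glue

variable {p n : ℕ}

/-- A corner flip at `τ` moves only the coordinates `τ − 1` and `τ`. -/
theorem cornerFlip_apply_of_ne (τ : ℕ) (u : Fin n → Bool) (i : Fin n) (h1 : i.val + 1 ≠ τ) (h2 : i.val ≠ τ) :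
    cornerFlip n τ u i = u i := by
  unfold cornerFlip
  split_ifs with h
  · simp only [Function.comp_apply]
    congr 1
    apply Equiv.swap_apply_of_ne_of_ne
    · intro he
      apply h1
      have := congrArg Fin.val he
      simp only at this
      omega
    · intro he
      apply h2
      have := congrArg Fin.val he
      simpa using this
  · rfl

/-- A corner flip at a time `τ` inside `(p, n − p)` that is not a pin time preserves every part. -/
theorem cornerFlip_mem_part (S : TwoStep p n) (d₀ : ℕ) (w : ZMod p) (u₀ : Fin n → Bool) (τ : ℕ)
    (h1 : p + 1 ≤ τ) (h2 : τ + p < n) (h3 : ∀ t ∈ pinTimes S d₀, t.val ≠ τ) (u : Fin n → Bool)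
    (hu : u ∈ part S d₀ w u₀) : cornerFlip n τ u ∈ part S d₀ w u₀ := by
  unfold part at hu ⊢
  rw [Finset.mem_filter] at hu ⊢
  refine ⟨?_, ?_⟩
  · have h := hu.1
    unfold Coset21.RungG.classOf at h ⊢
    rw [Finset.mem_filter] at h ⊢
    exact ⟨Finset.mem_univ _, by rw [wt_cornerFlip]; exact h.2⟩
  · rw [← hu.2]
    unfold pinKey
    refine Prod.ext (funext fun t => ?_) (funext fun i => ?_)
    · show (if t ∈ pinTimes S d₀ then ((wtPrefix (cornerFlip n τ u) t.val : ℕ) : ZMod p) else 0)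
          = (if t ∈ pinTimes S d₀ then ((wtPrefix u t.val : ℕ) : ZMod p) else 0)
      by_cases ht : t ∈ pinTimes S d₀
      · rw [if_pos ht, if_pos ht, wtPrefix_cornerFlip τ u (h3 t ht)]
      · rw [if_neg ht, if_neg ht]
    · show (if i ∈ bdry p n then cornerFlip n τ u i else false) = (if i ∈ bdry p n then u i else false)
      by_cases hi : i ∈ bdry p n
      · rw [if_pos hi, if_pos hi]
        unfold bdry at hi
        rw [Finset.mem_filter] at hi
        apply cornerFlip_apply_of_ne
        · omega
        · omega
      · rw [if_neg hi, if_neg hi]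

/-- The block form implies the peeling event. -/
theorem peelEvent_of_blockEvent (p d₀ τ x : ℕ) (u : Fin n → Bool) (hp : 1 ≤ p) (hlo : d₀ + 3 * p ≤ τ) (hhi : τ + d₀ + 1 ≤ n)
    (h : blockEvent p d₀ τ x (wtPrefix u (τ - d₀ - 3 * p)) (blockBits u (τ - d₀ - 3 * p) (ell p d₀))) :
    peelEvent n p d₀ τ x u := by
  obtain ⟨hpat, hres⟩ := h
  have haτ : (τ - d₀ - 3 * p) + d₀ + 3 * p = τ := by omega
  refine ⟨?_, ?_⟩
  · intro i hi1 hi2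
    have hai : τ - d₀ - 3 * p ≤ i.val := by omega
    have hj : i.val - (τ - d₀ - 3 * p) < ell p d₀ := by unfold ell; omega
    have h := hpat ⟨i.val - (τ - d₀ - 3 * p), hj⟩ (by simp only; omega)
    have hb : blockBits u (τ - d₀ - 3 * p) (ell p d₀) ⟨i.val - (τ - d₀ - 3 * p), hj⟩ = u i := by
      unfold blockBits
      simp only
      rw [dif_pos (by omega)]
      congr 1
      apply Fin.ext
      simp only
      omega
    rw [hb] at h
    rw [h]
    simp only
    omega
  · show wtPrefix u τ % (3 * p) = x
    have hmid := wtPrefix_eq_add_midCount u (show τ - d₀ - 3 * p ≤ τ by omega)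
    have hc : ((univ : Finset (Fin n)).filter fun i : Fin n => τ - d₀ - 3 * p ≤ i.val ∧ i.val < τ ∧ u i = true).card
        = ((univ : Finset (Fin (ell p d₀))).filter fun j =>
            (τ - d₀ - 3 * p) + j.val < τ ∧ blockBits u (τ - d₀ - 3 * p) (ell p d₀) j = true).card := by
      apply Finset.card_bij (fun (i : Fin n) hi => (⟨i.val - (τ - d₀ - 3 * p), by
          have h' := (Finset.mem_filter.mp hi).2; unfold ell; omega⟩ : Fin (ell p d₀)))
      · intro i hi
        simp only [Finset.mem_filter, Finset.mem_univ, true_and] at hi ⊢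
        refine ⟨by omega, ?_⟩
        unfold blockBits
        simp only
        rw [dif_pos (by omega)]
        have e : (⟨τ - d₀ - 3 * p + (i.val - (τ - d₀ - 3 * p)), by omega⟩ : Fin n) = i := by
          apply Fin.ext; simp only; omega
        rw [e]
        exact hi.2.2
      · intro i hi j hj hij
        simp only [Finset.mem_filter, Finset.mem_univ, true_and] at hi hj
        have := congrArg Fin.val hij
        simp only at this
        apply Fin.ext
        omega
      · intro j hj
        simp only [Finset.mem_filter, Finset.mem_univ, true_and] at hj
        have hjn : τ - d₀ - 3 * p + j.val < n := by omega
        refine ⟨⟨τ - d₀ - 3 * p + j.val, hjn⟩, ?_, ?_⟩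
        · simp only [Finset.mem_filter, Finset.mem_univ, true_and]
          refine ⟨by omega, hj.1, ?_⟩
          have hb := hj.2
          unfold blockBits at hb
          rw [dif_pos hjn] at hb
          exact hb
        · apply Fin.ext
          simp only
          omega
    rw [hmid, hc]
    exact hres

/-- Reachability: from every entry prefix weight some block realises the event (the `3p − 1` free bits reach every residue). -/
theorem blockEvent_reachable (p d₀ τ x : ℕ) (hp : 1 ≤ p) (hx : x < 3 * p) (hlo : d₀ + 3 * p ≤ τ) (z : ℕ) :
    ∃ b : Fin (ell p d₀) → Bool, blockEvent p d₀ τ x z b := by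
  have haτ : (τ - d₀ - 3 * p) + d₀ + 3 * p = τ := by omega
  -- `m` extra ones among the free positions, with `(z + m + 1) % 3p = x`
  obtain ⟨m, hm, hmx⟩ : ∃ m, m < 3 * p ∧ (z + m + 1) % (3 * p) = x := by
    have h3p : 0 < 3 * p := by omega
    refine ⟨(x + 3 * p - (z + 1) % (3 * p)) % (3 * p), Nat.mod_lt _ h3p, ?_⟩
    have hr : (z + 1) % (3 * p) < 3 * p := Nat.mod_lt _ h3p
    have h1 : Nat.ModEq (3 * p) (z + 1) ((z + 1) % (3 * p)) := (Nat.mod_modEq (z + 1) (3 * p)).symm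
    have h2 : Nat.ModEq (3 * p) ((x + 3 * p - (z + 1) % (3 * p)) % (3 * p)) (x + 3 * p - (z + 1) % (3 * p)) :=
      Nat.mod_modEq _ _
    have h3 := h1.add h2
    have e : (z + 1) % (3 * p) + (x + 3 * p - (z + 1) % (3 * p)) = x + 3 * p := by omega
    rw [e] at h3
    have e2 : z + (x + 3 * p - (z + 1) % (3 * p)) % (3 * p) + 1 = z + 1 + (x + 3 * p - (z + 1) % (3 * p)) % (3 * p) := by
      omega
    rw [e2, h3, Nat.add_mod_right, Nat.mod_eq_of_lt hx]
  refine ⟨fun j => decide (j.val < m) || decide (j.val = 3 * p + d₀ - 1), ?_, ?_⟩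
  · intro j hj
    simp only [Bool.or_eq_true, decide_eq_true_eq]
    constructor
    · rintro (h | h)
      · omega
      · omega
    · intro h
      right
      omega
  · -- the count is `m + 1`
    have hS : ((univ : Finset (Fin (ell p d₀))).filter fun j =>
          (τ - d₀ - 3 * p) + j.val < τ ∧ (decide (j.val < m) || decide (j.val = 3 * p + d₀ - 1)) = true)
        = ((univ : Finset (Fin (ell p d₀))).filter fun j => j.val < m) ∪
            {(⟨3 * p + d₀ - 1, by unfold ell; omega⟩ : Fin (ell p d₀))} := by
      ext j
      simp only [Finset.mem_filter, Finset.mem_univ, true_and, Finset.mem_union, Finset.mem_singleton,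
        Bool.or_eq_true, decide_eq_true_eq]
      constructor
      · rintro ⟨-, h | h⟩
        · exact Or.inl h
        · right; apply Fin.ext; simp only; exact h
      · rintro (h | h)
        · exact ⟨by omega, Or.inl h⟩
        · have := congrArg Fin.val h
          simp only at this
          exact ⟨by omega, Or.inr this⟩
    have hdisj : Disjoint (((univ : Finset (Fin (ell p d₀))).filter fun j => j.val < m))
        {(⟨3 * p + d₀ - 1, by unfold ell; omega⟩ : Fin (ell p d₀))} := by
      rw [Finset.disjoint_singleton_right, Finset.mem_filter]
      simp only [Finset.mem_univ, true_and, not_lt]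
      omega
    have hcm : (((univ : Finset (Fin (ell p d₀))).filter fun j => j.val < m)).card = m := by
      have e : (((univ : Finset (Fin (ell p d₀))).filter fun j => j.val < m)).image Fin.val = Finset.range m := by
        ext y
        simp only [Finset.mem_image, Finset.mem_filter, Finset.mem_univ, true_and, Finset.mem_range]
        constructor
        · rintro ⟨j, hj, rfl⟩; exact hj
        · intro hy; exact ⟨⟨y, by unfold ell; omega⟩, hy, rfl⟩
      rw [← Finset.card_image_of_injective _ Fin.val_injective, e, Finset.card_range]
    rw [hS, Finset.card_union_of_disjoint hdisj, hcm, Finset.card_singleton]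
    have e3 : z + (m + 1) = z + m + 1 := by ring
    rw [e3]
    exact hmx

/-- Selection: a residue class mod `ℓ` holds a `1/ℓ` fraction of `T`, and its members are `ℓ`-separated. -/
theorem select (ℓ : ℕ) (hℓ : 0 < ℓ) (T : Finset ℕ) :
    ∃ P : Finset ℕ, P ⊆ T ∧ T.card ≤ ℓ * P.card + (ℓ - 1) ∧ ∀ a ∈ P, ∀ b ∈ P, a < b → a + ℓ ≤ b := by
  have hmaps : ∀ a ∈ T, a % ℓ ∈ Finset.range ℓ := fun a _ => Finset.mem_range.mpr (Nat.mod_lt a hℓ)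
  obtain ⟨r, -, hr⟩ := Finset.exists_le_card_fiber_of_mul_le_card_of_maps_to (n := T.card / ℓ) hmaps
    (Finset.nonempty_range_iff.mpr hℓ.ne') (by rw [Finset.card_range]; exact Nat.mul_div_le T.card ℓ)
  refine ⟨T.filter fun a => a % ℓ = r, Finset.filter_subset _ _, ?_, ?_⟩
  · have h1 : ℓ * (T.card / ℓ) + T.card % ℓ = T.card := Nat.div_add_mod T.card ℓ
    have h2 : T.card % ℓ < ℓ := Nat.mod_lt _ hℓ
    have h3 : ℓ * (T.card / ℓ) ≤ ℓ * (T.filter fun a => a % ℓ = r).card := Nat.mul_le_mul_left ℓ hr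
    omega
  · intro a ha b hb hab
    rw [Finset.mem_filter] at ha hb
    have hmod : b % ℓ = a % ℓ := hb.2.trans ha.2.symm
    have h0 : (b - a) % ℓ = 0 := Nat.sub_mod_eq_zero_of_mod_eq hmod
    obtain ⟨q, hq⟩ := Nat.dvd_of_mod_eq_zero h0
    rcases Nat.eq_zero_or_pos q with hq0 | hq0
    · rw [hq0, mul_zero] at hq
      omega
    · have : ℓ ≤ ℓ * q := Nat.le_mul_of_pos_right ℓ hq0
      omega

end Glue

end DensePeel

end Summit.QuantumAdvantage.AdviceFreeQNC0.LocalEngine
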